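import Summits.BirchSwinnertonDyer.BirchSwinnertonDyer.Theorems.Rank1ResidualJetKolyvaginFrobeniusTorsion
import Summits.BirchSwinnertonDyer.BirchSwinnertonDyer.Theorems.KolyvaginRoadThreeMethod2KolyvaginLocalGross
import HarnessLib

/-!
# Route `AdditiveKolyvaginRoad`, crux `KolyvaginPrimitiveAdditive` (item stmt-BirchSwinnertonDyer-20132):
# stub LOC, inputs at Kolyvagin primes, general odd `p` — W. ZHANG'S KOLYVAGIN PRIMES ARE GROSS'S (the bridge to the
# tree's Gross 1991 apparatus: Frobenius lift, Prop. 9.6)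
# (cell `pub/bsd-wall`, lead prover `bsd-wall-akr-p1` g3; `--supports stmt-BirchSwinnertonDyer-20132`, helper;
# p-generic port of zhang3-p1's `…Method2KolyvaginLocalGross.lean`)

WHY THIS FILE. After `kolyvaginLocalPackageP_of_kolyvaginPrimePackage` (p533303) and (Tr-iso) (p535599), stub LOC of
skeleton v7.1 of crux 20132 is (Perf) + (Line) + (Supply). (Line) and (Perf) are read off Gross's FROBENIUS LIFT at a
Kolyvagin prime (`exists_frobeniusLift_of_isKolyvaginPrime`, tree, any odd `p`), which is stated for GROSS'S Kolyvagin
primes (`IsKolyvaginPrime`: (3.2) `Frob(ℓ) = Frob(∞)`); the crux speaks W. ZHANG'S (`Zhang2014.IsKolyvaginPrime`: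
`p ∣ ℓ + 1`, `p ∣ a_ℓ`). This file is the bridge at a general odd prime (the companion `…KolyvaginLine.lean` uses it).

WHAT (the level is written `p ^ 1`, the torsion level of the crux's `H¹(K, E[p])`).
* §1 `exists_conj_smul_eq_of_involutions_P` — two elements of `Γ_ℚ` acting on `E[q](ℚ̄)` with non-zero eigenvectors
  of both signs are conjugate on `E[q]` when `ρ̄_{E,q}` is onto (`q` an odd prime; eigenbases, `Basis.equiv`, lifted
  along `ρ̄`; zhang3-p1's with `3 ↦ q`, the `𝔽₃`-trick `x+x+x = 0` replaced by `2 ∈ 𝔽_q^×`).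
* §2 `frobEqFrobInfty_of_zhang_P`, `isKolyvaginPrime_pow_one_of_zhang` — W. ZHANG'S KOLYVAGIN PRIMES AT `p` ARE
  GROSS'S at level `p¹` (`Frob(ℓ) = Frob(∞)` in `Gal(K(E_p)/ℚ)`): Cayley–Hamilton `Frob_ℓ² = 1` on `E[p]` (bsd-jet
  `frob_smul_frob_smul_eq_self_of_dvd`), `det Frob_ℓ = ℓ ≡ −1 ≠ 1` (so `Frob_ℓ ≠ ±1`, eigenvectors of both signs),
  conjugation into a complex conjugation `c₀` by §1, and the restriction to `K` (`ℓ` inert, `K` totally complex).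

HONEST FRAMING: theorems only; 0 definitions, 0 named facts, 0 `sorry`; closes nothing.

References: [cite: GrossLMS1991, §3 (3.1)–(3.3)] [cite: WZhang2014, Notations (xii)] [cite: NeukirchANT1999, Ch. I §9
Prop. (9.4)] [cite: SilvermanAEC2009, Prop. VII.4.1].
-/

-- single-conjunct summit: `Summit.BirchSwinnertonDyer.BirchSwinnertonDyer.…` repeats the name by design
set_option linter.dupNamespace false

noncomputable section

open scoped Classical Pointwise

namespace Summit.BirchSwinnertonDyer.BirchSwinnertonDyer.Theorems.AdditiveKoly

open WeierstrassCurve Field Function NumberField IsDedekindDomain Rat.HeightOneSpectrum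
open Literature.NumberTheory.EllipticCurves Literature.NumberTheory.GaloisRepresentations Module
open Summit.BirchSwinnertonDyer.Rank1Residual.X11b.Three.Koly.Method2
open Summit.BirchSwinnertonDyer.Rank1Residual.JET

/-! ## §1 Two involution-like elements with both eigen-signs are conjugate on `E[q]` under surjectivity -/

section Involutions

variable (W : WeierstrassCurve ℚ) [W.IsElliptic] (q : ℕ) [Fact q.Prime]

/-- **Two elements of `Γ_ℚ` acting on `E[q](ℚ̄)` with eigenvectors of both signs are conjugate on `E[q]` when `ρ̄_{E,q}`
is onto** (`q` an odd prime): if `a, b ∈ Γ_ℚ` act on `E[q]`, each with a non-zero fixed vector and a non-zero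
anti-fixed vector, then `g a g⁻¹ = b` on `E[q]` for some `g ∈ Γ_ℚ` (eigenbases `{a₊, a₋}`, `{b₊, b₋}` of the `𝔽_q`-plane
`E[q]`, the conjugator `a± ↦ b±`, lifted along the surjection `ρ̄ : Γ_ℚ → Aut(E[q])`). [folklore] -/
theorem exists_conj_smul_eq_of_involutions_P (hq2 : q ≠ 2) (hsurj : W.HasSurjectiveModNGaloisRep ((q : ℕ) : ℤ))
    {a b : absoluteGaloisGroup ℚ} {a₁ a₂ b₁ b₂ : geomTorsion W ((q : ℕ) : ℤ)} (ha₁ : a • a₁ = a₁) (ha₁0 : a₁ ≠ 0)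
    (ha₂ : a • a₂ = -a₂) (ha₂0 : a₂ ≠ 0) (hb₁ : b • b₁ = b₁) (hb₁0 : b₁ ≠ 0) (hb₂ : b • b₂ = -b₂) (hb₂0 : b₂ ≠ 0) :
    ∃ g : absoluteGaloisGroup ℚ, ∀ P : geomTorsion W ((q : ℕ) : ℤ), g • a • g⁻¹ • P = b • P := by
  have hq : q.Prime := Fact.out
  letI : Module (ZMod q) (geomTorsion W ((q : ℕ) : ℤ)) := AddSubgroup.torsionBy.zmodModule
  have h2 : Module.finrank (ZMod q) (geomTorsion W ((q : ℕ) : ℤ)) = 2 :=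
    Literature.RepresentationTheory.FiniteGroups.Representation.finrank_eq_two_of_natCard_eq_sq
      (card_torsionPoints_eq_sq_holds W (AlgebraicClosure ℚ) (n := q) (by exact_mod_cast hq.ne_zero))
  haveI : FiniteDimensional (ZMod q) (geomTorsion W ((q : ℕ) : ℤ)) := Module.finite_of_finrank_eq_succ h2
  -- the `ZMod q`-linear maps of `a`, `b`
  set fa := (galoisRepTorsion W ((q : ℕ) : ℤ) a).toAdd.toAddMonoidHom.toZModLinearMap q with hfadef
  set fb := (galoisRepTorsion W ((q : ℕ) : ℤ) b).toAdd.toAddMonoidHom.toZModLinearMap q with hfbdef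
  have hfa : ∀ Q, fa Q = a • Q := fun Q => rfl
  have hfb : ∀ Q, fb Q = b • Q := fun Q => rfl
  -- `2` is invertible in `𝔽_q`
  have htwo : (2 : ZMod q) ≠ 0 := by
    intro h
    have h' : ((2 : ℕ) : ZMod q) = 0 := by exact_mod_cast h
    rw [ZMod.natCast_eq_zero_iff] at h'
    exact hq2 ((Nat.prime_dvd_prime_iff_eq hq Nat.prime_two).mp h')
  -- eigenvectors for `+1`/`−1` of a linear map are linearly independent (`1 ≠ −1` in `𝔽_q`)
  have hli : ∀ (φ : geomTorsion W ((q : ℕ) : ℤ) →ₗ[ZMod q] geomTorsion W ((q : ℕ) : ℤ))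
      {x₁ x₂ : geomTorsion W ((q : ℕ) : ℤ)}, φ x₁ = x₁ → x₁ ≠ 0 →
      φ x₂ = -x₂ → x₂ ≠ 0 → LinearIndependent (ZMod q) ![x₁, x₂] := by
    intro φ x₁ x₂ hx₁ hx₁0 hx₂ hx₂0
    rw [LinearIndependent.pair_iff]
    intro c d hcd
    have hs : φ (c • x₁ + d • x₂) = c • x₁ - d • x₂ := by
      rw [map_add, map_smul, map_smul, hx₁, hx₂, smul_neg, sub_eq_add_neg]
    rw [hcd, map_zero] at hs
    -- `c • x₁ - d • x₂ = 0` and `c • x₁ + d • x₂ = 0` give `2 • (c • x₁) = 0`, so `c • x₁ = 0 = d • x₂`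
    have hc2 : (2 : ZMod q) • (c • x₁) = 0 := by
      rw [two_smul]
      have := congrArg₂ (· + ·) hcd hs.symm
      simp only [add_zero] at this
      rw [← this]; abel
    have hc1 : c • x₁ = 0 := (smul_eq_zero.mp hc2).resolve_left htwo
    have hd1 : d • x₂ = 0 := by rw [hc1, zero_add] at hcd; exact hcd
    exact ⟨(smul_eq_zero.mp hc1).resolve_right hx₁0, (smul_eq_zero.mp hd1).resolve_right hx₂0⟩
  have hcard : Fintype.card (Fin 2) = Module.finrank (ZMod q) (geomTorsion W ((q : ℕ) : ℤ)) := by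
    rw [Fintype.card_fin, h2]
  let bA := basisOfLinearIndependentOfCardEqFinrank
    (hli fa (by rw [hfa, ha₁]) ha₁0 (by rw [hfa, ha₂]) ha₂0) hcard
  let bB := basisOfLinearIndependentOfCardEqFinrank
    (hli fb (by rw [hfb, hb₁]) hb₁0 (by rw [hfb, hb₂]) hb₂0) hcard
  have hbA0 : bA 0 = a₁ := by rw [coe_basisOfLinearIndependentOfCardEqFinrank]; rfl
  have hbA1 : bA 1 = a₂ := by rw [coe_basisOfLinearIndependentOfCardEqFinrank]; rfl
  have hbB0 : bB 0 = b₁ := by rw [coe_basisOfLinearIndependentOfCardEqFinrank]; rfl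
  have hbB1 : bB 1 = b₂ := by rw [coe_basisOfLinearIndependentOfCardEqFinrank]; rfl
  -- the conjugator `M : a± ↦ b±`
  let M : geomTorsion W ((q : ℕ) : ℤ) ≃ₗ[ZMod q] geomTorsion W ((q : ℕ) : ℤ) := bA.equiv bB (Equiv.refl _)
  have hM0 : M a₁ = b₁ := by rw [← hbA0, Basis.equiv_apply, Equiv.refl_apply, hbB0]
  have hM1 : M a₂ = b₂ := by rw [← hbA1, Basis.equiv_apply, Equiv.refl_apply, hbB1]
  have hMA : ∀ P, M (a • P) = b • M P := by
    have hlin : M.toLinearMap ∘ₗ fa = fb ∘ₗ M.toLinearMap := by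
      refine bA.ext fun i ↦ ?_
      fin_cases i
      · change M (fa (bA 0)) = fb (M (bA 0))
        rw [hfa, hfb, hbA0, ha₁, hM0, hb₁]
      · change M (fa (bA 1)) = fb (M (bA 1))
        rw [hfa, hfb, hbA1, ha₂, map_neg, hM1, hb₂]
    intro P
    have := congrArg (fun f ↦ f P) hlin
    simpa only [LinearMap.comp_apply, LinearEquiv.coe_coe, hfa, hfb] using this
  -- lift `M` to `g ∈ Γ_ℚ`
  obtain ⟨g, hg⟩ := hsurj (Multiplicative.ofAdd M.toAddEquiv)
  have hgP : ∀ P, g • P = M P := fun P ↦ by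
    have := congrArg (fun φ ↦ (Multiplicative.toAdd φ) P) hg
    simpa using this
  refine ⟨g, fun P ↦ ?_⟩
  have hg' : g⁻¹ • P = M.symm P := by
    rw [inv_smul_eq_iff, hgP, LinearEquiv.apply_symm_apply]
  rw [hg', hgP, hMA, LinearEquiv.apply_symm_apply]

end Involutions

/-! ## §2 W. Zhang's Kolyvagin primes are Gross's, at a general odd prime (level `p ^ 1`) -/

section Bridge

variable (W : WeierstrassCurve ℚ) (K : Type) [Field K] [NumberField K] (p : ℕ) [W.IsElliptic] [W.IsGloballyMinimal]
  [Fact p.Prime]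

/-- **W. Zhang's Kolyvagin primes at `p` satisfy Gross's (3.2) (level `p¹`) when `ρ̄_{E,p}` is onto and `p` is odd**:
for `K` imaginary quadratic, `Frob(ℓ) = Frob(∞)` in `Gal(K(E_p)/ℚ)`. Proof (zhang3-p1's at `p = 3`, generalised):
a Frobenius `h₀` above `ℓ` has `h₀² = 1` on `E[p]` (bsd-jet `frob_smul_frob_smul_eq_self_of_dvd`: `a_ℓ ≡ 0`,
`ℓ ≡ −1`) and `det h₀ = ℓ ≡ −1 ≠ ±1²`-compatible with neither `h₀ = 1` nor `h₀ = −1` (`p` odd), so it has non-zero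
eigenvectors of both signs; so does a complex conjugation `c₀` (`RatClosure.exists_eigenvectors`); §1 conjugates `h₀`
into `c₀` on `E[p]`, and on `K` both restrict to the non-trivial automorphism (`ℓ` inert, `K` totally complex).
[cite: GrossLMS1991, §3 (3.2)–(3.3)] [cite: WZhang2014, Notations (xii)] -/
theorem frobEqFrobInfty_of_zhang_P (hK : IsImaginaryQuadratic K) (hp2 : p ≠ 2)
    (hsurj : W.HasSurjectiveModNGaloisRep p) {ℓ : ℕ}
    (hℓ : Zhang2014.IsKolyvaginPrime (W.conductorNorm ℤ) W K p ℓ) : FrobEqFrobInfty W K (p ^ 1) ℓ := by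
  have hp : p.Prime := Fact.out
  haveI hp1 : Fact (Nat.Prime (p ^ 1)) := ⟨by rw [pow_one]; exact hp⟩
  haveI : Fact (2 < p ^ 1) := ⟨by rw [pow_one]; exact lt_of_le_of_ne hp.two_le (Ne.symm hp2)⟩
  have hne1 : (-1 : ZMod (p ^ 1)) ≠ 1 := ZMod.neg_one_ne_one
  haveI : Algebra.IsQuadraticExtension ℚ K := ⟨hK.1⟩
  haveI : IsTotallyComplex K := hK.2
  have hℓp : ℓ.Prime := hℓ.1
  haveI : Fact ℓ.Prime := ⟨hℓp⟩
  have hℓp' : ℓ ≠ p := hℓ.2.2.2.1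
  have hℓq : ℓ ≠ p ^ 1 := by rw [pow_one]; exact hℓp'
  have hℓP : (Ideal.span {(ℓ : 𝓞 K)}).IsPrime := hℓ.2.2.2.2.1
  have hdvd := Zhang2014.IsKolyvaginPrime.dvd (p := p) hℓ
  -- ### places: `w = (ℓ)` in `K`, `v₁` below it in `ℚ`, a prime `𝔓 ∣ w` of `\bar ℤ_K`, `𝔓' = 𝔓 ∩ \bar ℤ`
  let w : HeightOneSpectrum (𝓞 K) := ⟨Ideal.span {(ℓ : 𝓞 K)}, hℓP, by
    rw [Ne, Ideal.span_singleton_eq_bot]; exact_mod_cast hℓp.ne_zero⟩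
  have hw : (ℓ : 𝓞 K) ∈ w.asIdeal := Ideal.mem_span_singleton_self _
  set v₁ : HeightOneSpectrum (𝓞 ℚ) := w.under (𝓞 ℚ) with hv₁
  have hwv₁ : w.asIdeal.under (𝓞 ℚ) = v₁.asIdeal := rfl
  have hℓv₁ : (ℓ : 𝓞 ℚ) ∈ v₁.asIdeal := by
    rw [← hwv₁, Ideal.under_def, Ideal.mem_comap, map_natCast]; exact hw
  have hv₁ℓ : (primesEquiv v₁ : ℕ) = ℓ := primesEquiv_eq_of_natCast_mem hℓp hℓv₁
  obtain ⟨𝔐, h𝔐⟩ := w.localPrimesAbove_nonempty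
  set 𝔓 := w.primeBelow (closureEmb (K := K) (w.adicCompletion K)) 𝔐 with h𝔓def
  have h𝔓 : 𝔓 ∈ w.primesAbove := HeightOneSpectrum.primeBelow_mem_primesAbove h𝔐
  set 𝔓' := 𝔓.comap (absIntegersMap ℚ K) with h𝔓'def
  have h𝔓' : 𝔓' ∈ v₁.primesAbove := comap_absIntegersMap_mem_primesAbove hwv₁ h𝔓
  have hgood₁ : W.HasGoodReductionAt v₁ :=
    LocalFrob.hasGoodReductionAt_rat_of_not_dvd_conductorNorm W hℓp hℓ.2.1 v₁ hℓv₁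
  have hgood : W.HasGoodReductionAtPrime ℓ := (hasGoodReductionAtPrime_primesEquiv_iff_holds W v₁ ℓ hv₁ℓ).mpr hgood₁
  -- ### the two involutions: a Frobenius `h₀` above `ℓ` and a complex conjugation `c₀`
  obtain ⟨h₀, hh₀⟩ := HeightOneSpectrum.exists_isArithFrobAt_of_mem_primesAbove_holds h𝔓'
  obtain ⟨c₀, hc₀⟩ := exists_isComplexConjugation (Rat.castHom ℝ)
  have hne' : ((primesEquiv v₁ : Nat.Primes) : ℕ) ≠ p := by rw [hv₁ℓ]; exact hℓp'
  have h1' : p ^ 1 ∣ ((primesEquiv v₁ : Nat.Primes) : ℕ) + 1 := by rw [hv₁ℓ, pow_one]; exact hdvd.1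
  have ha' : ((p ^ 1 : ℕ) : ℤ) ∣ W.frobeniusTrace (primesEquiv v₁) := by
    rw [pow_one]
    have : ((primesEquiv v₁ : Nat.Primes) : ℕ) = ℓ := hv₁ℓ
    rw [this]; exact hdvd.2
  have hA2 : ∀ P : geomTorsion W ((p ^ 1 : ℕ) : ℤ), h₀ • h₀ • P = P := fun P ↦
    GlobalDuality.frob_smul_frob_smul_eq_self_of_dvd W p hne' hgood₁ h1' ha' ⟨𝔓', h𝔓', hh₀⟩ P
  have hWq : W.exists_weilPairing (p ^ 1) := exists_weilPairing_holds W (p ^ 1)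
  obtain ⟨⟨b₁, hb₁0, hb₁⟩, ⟨b₂, hb₂0, hb₂⟩⟩ :=
    RatClosure.exists_eigenvectors W hc₀ hWq (by rw [pow_one]; exact hp2)
  -- eigenvectors of `h₀`: `h₀ ≠ ±1` on `E[p]` since `det h₀ = ℓ ≡ −1`
  letI : Module (ZMod (p ^ 1)) (geomTorsion W ((p ^ 1 : ℕ) : ℤ)) := AddSubgroup.torsionBy.zmodModule
  have h2 : Module.finrank (ZMod (p ^ 1)) (geomTorsion W ((p ^ 1 : ℕ) : ℤ)) = 2 :=
    Literature.RepresentationTheory.FiniteGroups.Representation.finrank_eq_two_of_natCard_eq_sq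
      (card_torsionPoints_eq_sq_holds W (AlgebraicClosure ℚ) (n := p ^ 1) (by exact_mod_cast hp1.out.ne_zero))
  haveI : FiniteDimensional (ZMod (p ^ 1)) (geomTorsion W ((p ^ 1 : ℕ) : ℤ)) := Module.finite_of_finrank_eq_succ h2
  set f := (galoisRepTorsion W ((p ^ 1 : ℕ) : ℤ) h₀).toAdd.toAddMonoidHom.toZModLinearMap (p ^ 1) with hfdef
  have hf : ∀ Q, f Q = h₀ • Q := fun Q => rfl
  have hdet : LinearMap.det f = (ℓ : ZMod (p ^ 1)) :=
    W.det_galoisRepTorsion_frobenius_eq (p ^ 1) hℓq hgood hv₁ℓ h𝔓' hh₀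
  have hℓm : (ℓ : ZMod (p ^ 1)) = -1 := by
    have h3 : ((ℓ + 1 : ℕ) : ZMod (p ^ 1)) = 0 := by
      rw [ZMod.natCast_eq_zero_iff, pow_one]; exact hdvd.1
    rw [Nat.cast_add, Nat.cast_one] at h3
    exact eq_neg_of_add_eq_zero_left h3
  have hnot_id : ¬ ∀ P : geomTorsion W ((p ^ 1 : ℕ) : ℤ), h₀ • P = P := by
    intro hall
    have hfid : f = LinearMap.id := LinearMap.ext fun P ↦ by rw [hf, hall]; rfl
    have : LinearMap.det f = 1 := by rw [hfid, LinearMap.det_id]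
    rw [hdet, hℓm] at this
    exact hne1 this
  have hnot_neg : ¬ ∀ P : geomTorsion W ((p ^ 1 : ℕ) : ℤ), h₀ • P = -P := by
    intro hall
    have hfid : f = (-1 : ZMod (p ^ 1)) • LinearMap.id := LinearMap.ext fun P ↦ by
      rw [hf, hall, LinearMap.smul_apply, LinearMap.id_apply, neg_one_smul]
    have : LinearMap.det f = 1 := by
      rw [hfid, LinearMap.det_smul, LinearMap.det_id, h2]; norm_num
    rw [hdet, hℓm] at this
    exact hne1 this
  obtain ⟨u, hu⟩ := not_forall.mp hnot_neg
  obtain ⟨u', hu'⟩ := not_forall.mp hnot_id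
  have ha₁ : h₀ • (h₀ • u + u) = h₀ • u + u := by rw [smul_add, hA2, add_comm]
  have ha₁0 : h₀ • u + u ≠ 0 := fun h0 ↦ hu (eq_neg_of_add_eq_zero_left h0)
  have ha₂ : h₀ • (h₀ • u' - u') = -(h₀ • u' - u') := by rw [smul_sub, hA2, neg_sub]
  have ha₂0 : h₀ • u' - u' ≠ 0 := fun h0 ↦ hu' (sub_eq_zero.mp h0)
  -- ### conjugate `h₀` into `c₀` on `E[p]`
  have hsurj' : W.HasSurjectiveModNGaloisRep (((p ^ 1 : ℕ) : ℕ) : ℤ) := by rw [pow_one]; exact hsurj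
  obtain ⟨g, hg⟩ := exists_conj_smul_eq_of_involutions_P W (p ^ 1) (by rw [pow_one]; exact hp2) hsurj' ha₁ ha₁0 ha₂
    ha₂0 hb₁ hb₁0 hb₂ hb₂0
  set h := g * h₀ * g⁻¹ with hhdef
  have hhP : ∀ P : geomTorsion W (p ^ 1), h • P = c₀ • P := fun P ↦ by
    rw [hhdef, mul_smul, mul_smul]; exact hg P
  have hhFrob : IsArithFrobAt (𝓞 ℚ) h (g • 𝔓') := hh₀.conj g
  -- ### on `K`: `h` and `c₀` both restrict to the non-trivial automorphism
  letI : Algebra K (AlgebraicClosure ℚ) := (absEmbedding ℚ K).toRingHom.toAlgebra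
  haveI : IsScalarTower ℚ K (AlgebraicClosure ℚ) :=
    IsScalarTower.of_algebraMap_eq fun r ↦ ((absEmbedding ℚ K).commutes r).symm
  let r : absoluteGaloisGroup ℚ →* (K ≃ₐ[ℚ] K) :=
    (AlgEquiv.restrictNormalHom K).comp (absoluteGaloisGroup.toAlgEquiv ℚ).toMonoidHom
  have hr : ∀ (σ : absoluteGaloisGroup ℚ) (x : K), σ • absEmbedding ℚ K x = absEmbedding ℚ K (r σ x) := fun σ x ↦ by
    have := AlgEquiv.restrictNormal_commutes (absoluteGaloisGroup.toAlgEquiv ℚ σ) K x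
    rw [absoluteGaloisGroup.smul_def]
    exact this.symm
  -- `r σ = 1` iff `σ ∈ res Γ_K`
  have hrange : ∀ σ : absoluteGaloisGroup ℚ, r σ = 1 → σ ∈ (absGaloisRestrict ℚ K).range := by
    intro σ hσ
    rw [mem_range_absGaloisRestrict_iff_smul_absEmbedding]
    intro x
    rw [hr, hσ, AlgEquiv.one_apply]
  -- `r h₀ ≠ 1` (`ℓ` inert: residue degree `2`), hence `r h ≠ 1`; `r c₀ ≠ 1` (`K` totally complex)
  have hf2 := LocalFrob.inertiaDeg_eq_two_of_isPrime_span K hK.1 hℓp hℓP w hw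
  have hrh₀ : r h₀ ≠ 1 := by
    intro h1
    obtain ⟨τ, hτ⟩ := MonoidHom.mem_range.mp (hrange h₀ h1)
    have hτ' : absGaloisRestrict ℚ K τ = h₀ := hτ
    have hf1 := inertiaDeg_eq_one_of_isArithFrobAt_absGaloisRestrict (F := ℚ) (M := K) hwv₁ h𝔓 (τ := τ)
      (by rw [hτ']; exact hh₀)
    rw [hf2] at hf1
    exact absurd hf1 (by norm_num)
  have hrc₀ : r c₀ ≠ 1 := fun h1 ↦
    Rat.not_mem_range_absGaloisRestrict_of_isComplexConjugation K hK.2 hc₀ (hrange c₀ h1)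
  have hcard : Nat.card (K ≃ₐ[ℚ] K) = 2 := by rw [IsGalois.card_aut_eq_finrank, hK.1]
  obtain ⟨y, -, hy⟩ := (Nat.card_eq_two_iff' (1 : K ≃ₐ[ℚ] K)).mp hcard
  have hrh : r h = y := by
    have hrh0 : r h₀ = y := hy _ hrh₀
    rw [hhdef, map_mul, map_mul, map_inv, hrh0]
    by_cases hrg : r g = 1
    · rw [hrg, one_mul, inv_one, mul_one]
    · rw [hy _ hrg, mul_inv_cancel_right]
  have hmem : c₀⁻¹ * h ∈ (absGaloisRestrict ℚ K).range := by
    refine hrange _ ?_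
    rw [map_mul, map_inv, hrh, hy _ hrc₀, inv_mul_cancel]
  obtain ⟨τ, hτ⟩ := MonoidHom.mem_range.mp hmem
  have hτ' : absGaloisRestrict ℚ K τ = c₀⁻¹ * h := hτ
  -- ### assemble (3.2)
  refine ⟨v₁, g • 𝔓', h, c₀, hℓv₁, smul_mem_primesAbove h𝔓' g, hhFrob, hc₀, hhP, fun e x ↦ ?_⟩
  have hh' : h = c₀ * absGaloisRestrict ℚ K τ := by rw [hτ', mul_inv_cancel_left]
  rw [hh', mul_smul, absGaloisRestrict_smul_apply_eq τ e x]

/-- **W. Zhang's Kolyvagin primes at `p` are Gross's Kolyvagin primes at level `p¹`** (at a ♯-type frame: `K`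
imaginary quadratic, `p` odd, `ρ̄_{E,p}` onto): `Zhang2014.IsKolyvaginPrime N W K p ℓ → IsKolyvaginPrime N W K (p^1) ℓ`
with `N = N_E`. [cite: GrossLMS1991, §3 (3.1)–(3.3)] [cite: WZhang2014, Notations (xii)] -/
theorem isKolyvaginPrime_pow_one_of_zhang (hK : IsImaginaryQuadratic K) (hp2 : p ≠ 2)
    (hsurj : W.HasSurjectiveModNGaloisRep p) {ℓ : ℕ}
    (hℓ : Zhang2014.IsKolyvaginPrime (W.conductorNorm ℤ) W K p ℓ) :
    IsKolyvaginPrime (W.conductorNorm ℤ) W K (p ^ 1) ℓ :=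
  ⟨hℓ.1, hℓ.2.1, hℓ.2.2.1, by rw [pow_one]; exact hℓ.2.2.2.1, hℓ.2.2.2.2.1,
    frobEqFrobInfty_of_zhang_P W K p hK hp2 hsurj hℓ⟩

end Bridge

end Summit.BirchSwinnertonDyer.BirchSwinnertonDyer.Theorems.AdditiveKoly

end
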